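import Mathlib.LinearAlgebra.Charpoly.BaseChange
import Literature.AlgebraicGeometry.Motives.AbelianVarietyCotangentOfFibre
import HarnessLib

/-!
# The cotangent space of a fibre of a model, II: equivariance and characteristic polynomials

Topic `Literature/AlgebraicGeometry/Motives`, namespace `Literature.AlgebraicGeometry.Motives.AbelianVariety`.  THEOREMS
only; no named fact (net debt 0).  Sequel of `Motives/AbelianVarietyCotangentOfFibre` (`Φ = cotangentFibreEquiv :
κ ⊗_R I/I² ≃ T_e^*(A)` for a fibre `A = X ×_R κ` of an `R`-scheme with a section in the affine chart `W`) and of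
`Morphisms/SectionConormalChart` (`γ_v = sectionConormalEndo`, the action on `I/I²` of an `R`-endomorphism `v` of `X`
fixing the section, through `v^♯ : Γ(X, W) → Γ(X, D(h))`).  Brick G3b-3 of cell `hodgecm-mathlib`, row II-2β.

THE PRINT.  Görtz–Wedhorn II, Remark 17.14 (functoriality of the conormal module along the commutative square
`e = v ∘ e`), base-changed to the fibre, and Görtz–Wedhorn I, Remark 6.3 (3) (`u^*` on `𝔪_e/𝔪_e²`); the consequence
for characteristic polynomials is the scheme-theoretic form of Shimura's specialisation argument ([Shimura1998] §12.4,
Prop. 26, p. 109): the cotangent characteristic polynomial of an endomorphism of a model is ONE polynomial over `R`, read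
in every fibre through `R → κ`.

WHAT IS PROVED (`u : A ⟶ A` an endomorphism of the fibre COVERING `v`, `hu : Hom.toSchemeHom u ≫ p = p ≫ v`;
`h ∈ Γ(X, W)` with `e^♯ h = 1` and `D(h) ⊆ v⁻¹W`, cf. `exists_sectionAug_eq_one_and_basicOpen_le`):
* `cotangentMap_cotangentFibreMap`, `cotangentMap_comp_cotangentFibreEquiv` — **`u^* ∘ Φ = Φ ∘ (κ ⊗ γ_v)`**;
* `cotangentMap_eq_conj` — `u^* = Φ (κ ⊗ γ_v) Φ⁻¹`;
* **`charpoly_cotangentMap_eq_map_charpoly`** — if `I/I²` is free of finite rank over `R`: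
  `(cotangentMap A u).charpoly = (γ_v.charpoly).map (algebraMap R κ)`.

## References
* [GortzWedhorn2023] U. Görtz, T. Wedhorn, *Algebraic Geometry II* (2023), Remark 17.14, Remark 17.15 (1).
* [GortzWedhorn2020] U. Görtz, T. Wedhorn, *Algebraic Geometry I*, 2nd ed. (2020), Remark 6.3 (3), Remark 6.12 (2)–(3).
* [Shimura1998] G. Shimura, *Abelian Varieties with Complex Multiplication and Modular Functions* (1998), §12.4 Prop. 26.
-/

noncomputable section

-- `TopCat.Presheaf` is not reducible (as in Mathlib's `AlgebraicGeometry/Modules`).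
set_option backward.isDefEq.respectTransparency false

open CategoryTheory CategoryTheory.Limits AlgebraicGeometry TopologicalSpace Opposite TensorProduct
open Literature.RingTheory.Smooth

universe u

namespace Literature.AlgebraicGeometry.Motives

namespace AbelianVariety

open Literature.AlgebraicGeometry.Morphisms Literature.AlgebraicGeometry.Morphisms.ChartRing

variable {R κ : Type u} [CommRing R] [Field κ] [Algebra R κ] {X : Scheme.{u}} (f : X ⟶ Spec (.of R))
  (e : Spec (.of R) ⟶ X) (he : e ≫ f = 𝟙 _) {W : X.Opens} (hW : IsAffineOpen W) (heW : e ⁻¹ᵁ W = ⊤)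
  (A : AbelianVariety κ) (p : A.X.left ⟶ X)
  (hP : IsPullback p A.X.hom f (Spec.map (CommRingCat.ofHom (algebraMap R κ))))
  (horig : unitPt A ≫ p = Spec.map (CommRingCat.ofHom (algebraMap R κ)) ≫ e)

/-! ### Applied forms of Mathlib's `appLE` composition lemmas -/

section AppLE

variable {X' Y Z : Scheme.{u}}

/-- `f^♯_{V ≤ W} (g^♯_{U ≤ V} x) = (f ≫ g)^♯_{U ≤ W} x` (Mathlib `Scheme.Hom.appLE_comp_appLE`, applied). [folklore] -/
private theorem appLE_appLE_apply (f : X' ⟶ Y) (g : Y ⟶ Z) (U : Z.Opens) (V : Y.Opens) (W : X'.Opens)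
    (e₁ : V ≤ g ⁻¹ᵁ U) (e₂ : W ≤ f ⁻¹ᵁ V) (x : Γ(Z, U)) :
    f.appLE V W e₂ (g.appLE U V e₁ x) = (f ≫ g).appLE U W (e₂.trans ((Opens.map f.base).map (homOfLE e₁)).le) x := by
  have := congrArg (fun φ => φ.hom x) (Scheme.Hom.appLE_comp_appLE f g U V W e₁ e₂)
  simpa only [CommRingCat.hom_comp, RingHom.comp_apply] using this

/-- `appLE` along equal morphisms. [folklore] -/
private theorem appLE_congr_hom {g g' : Y ⟶ Z} (hg : g = g') (U : Z.Opens) (V : Y.Opens)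
    (hUV : V ≤ g ⁻¹ᵁ U) : g.appLE U V hUV = g'.appLE U V (hg ▸ hUV) := by
  subst hg; rfl

end AppLE

/-! ## §7 Equivariance under an endomorphism fixing the section; characteristic polynomials -/

section Endo

variable (hU : IsAffineOpen (p ⁻¹ᵁ W)) (heU : origin A ∈ p ⁻¹ᵁ W)
  (v : X ⟶ X) (hv : v ≫ f = f) (hev : e ≫ v = e) (u : A ⟶ A) (hu : Hom.toSchemeHom u ≫ p = p ≫ v)
  (h : ChartRing f W) (hh : sectionAug f e he heW h = 1) (hhv : X.basicOpen (val h) ≤ v ⁻¹ᵁ W)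

include hu hhv in
omit [Algebra R κ] in
/-- `p⁻¹ D(h) ⊆ u⁻¹ (p⁻¹ W)` when `D(h) ⊆ v⁻¹ W` and `u` covers `v`. [folklore] -/
private theorem preimage_basicOpen_le : p ⁻¹ᵁ X.basicOpen (val h) ≤ (Hom.toSchemeHom u) ⁻¹ᵁ (p ⁻¹ᵁ W) := by
  intro x hx
  change (Hom.toSchemeHom u ≫ p).base x ∈ W
  rw [hu]
  exact hhv hx

/-- `(𝟙 A)^♯_{U ≤ V} = restriction`. [folklore] -/
private theorem id_appLE_apply {U V : A.X.left.Opens} (hVU : V ≤ (Hom.toSchemeHom (𝟙 A)) ⁻¹ᵁ U) (y : Γ(A.X.left, U)) :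
    (Hom.toSchemeHom (𝟙 A)).appLE U V hVU y = A.X.left.presheaf.map (homOfLE hVU).op y := by
  change (Scheme.Hom.appLE (𝟙 A.X.left) U V hVU) y = _
  rw [Scheme.Hom.appLE, Scheme.Hom.id_app, Category.id_comp]
  rfl

/-- `res (p^♯ y) = p^♯ (res y)` (naturality of `p^♯`, applied). [folklore] -/
private theorem map_app_apply {U U' : X.Opens} (i : U' ≤ U) (y : Γ(X, U)) :
    A.X.left.presheaf.map (homOfLE ((Opens.map p.base).map (homOfLE i)).le).op (p.app U y) =
      p.app U' (X.presheaf.map (homOfLE i).op y) := by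
  have := congrArg (fun φ => φ.hom y) (p.naturality (homOfLE i).op)
  simp only [CommRingCat.hom_comp, RingHom.comp_apply] at this
  exact this.symm

include hu in
omit [Algebra R κ] in
/-- `u^♯ (p^♯ y) = p^♯ (v^♯ y)` on the charts `U = p⁻¹W ⊇ V = p⁻¹D(h)`. [folklore] -/
private theorem appLE_app_apply (hVU : p ⁻¹ᵁ X.basicOpen (val h) ≤ (Hom.toSchemeHom u) ⁻¹ᵁ (p ⁻¹ᵁ W)) (y : Γ(X, W)) :
    (Hom.toSchemeHom u).appLE (p ⁻¹ᵁ W) (p ⁻¹ᵁ X.basicOpen (val h)) hVU (p.app W y) =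
      p.app (X.basicOpen (val h)) (v.appLE W (X.basicOpen (val h)) hhv y) := by
  rw [← Scheme.Hom.appLE_eq_app p (U := W), ← Scheme.Hom.appLE_eq_app p (U := X.basicOpen (val h)),
    appLE_appLE_apply, appLE_appLE_apply, appLE_congr_hom hu]

include hW hP horig hev hu in
/-- **Equivariance: `u^* ∘ (κ ⊗_R I/I² → T_e^*(A)) = (κ ⊗_R I/I² → T_e^*(A)) ∘ (κ ⊗ γ_v)`**, where `γ_v = sectionConormalEndo`
is the action of `v` on `I/I²` and `u` the endomorphism of the fibre covering `v` (`u ≫ p = p ≫ v`)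
(Görtz–Wedhorn II, Remark 17.14: functoriality of the conormal module in the square `e = v ∘ e`, base-changed to the
fibre; Görtz–Wedhorn I, Remark 6.3 (3) for `u^*`). [cite: GortzWedhorn2023, Remark 17.14] [cite: GortzWedhorn2020, Remark 6.3 (3)] -/
theorem cotangentMap_cotangentFibreMap (z : κ ⊗[R] (augIdeal (sectionAug f e he heW)).Cotangent) :
    cotangentMap A u (cotangentFibreMap f e he hW heW A p hP horig hU heU z) =
      cotangentFibreMap f e he hW heW A p hP horig hU heU
        ((sectionConormalEndo f e he heW v hv hev h hhv hW hh).baseChange κ z) := by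
  letI := TopCat.Presheaf.algebra_section_stalk A.X.left.presheaf ⟨origin A, heU⟩
  letI : Module κ (IsLocalRing.maximalIdeal (stalkOrigin A)).Cotangent := Cotangent.instModule (A := A)
  -- the smaller charts `W' = D(h) ⊆ W`, `V = p⁻¹W' ⊆ U`
  have heW' : e ⁻¹ᵁ X.basicOpen (val h) = ⊤ := preimage_basicOpen_eq_top f e he heW h hh
  have hW' : IsAffineOpen (X.basicOpen (val h)) := hW.basicOpen (val h)
  have hV : IsAffineOpen (p ⁻¹ᵁ X.basicOpen (val h)) := isAffineOpen_preimage_of_isPullback f p A.X.hom hP hW'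
  have heV : origin A ∈ p ⁻¹ᵁ X.basicOpen (val h) := origin_mem_preimage e A p horig _ heW'
  have hVU : p ⁻¹ᵁ X.basicOpen (val h) ≤ (Hom.toSchemeHom u) ⁻¹ᵁ (p ⁻¹ᵁ W) := preimage_basicOpen_le f A p v u hu h hhv
  have hVU₁ : p ⁻¹ᵁ X.basicOpen (val h) ≤ (Hom.toSchemeHom (𝟙 A)) ⁻¹ᵁ (p ⁻¹ᵁ W) :=
    fun x hx => X.basicOpen_le (val h) hx
  letI := TopCat.Presheaf.algebra_section_stalk A.X.left.presheaf ⟨origin A, heV⟩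
  haveI := ChartRing.isLocalization_away f hW h
  induction z using TensorProduct.induction_on with
  | zero => simp only [map_zero]
  | add x y hx hy => simp only [map_add, hx, hy]
  | tmul c m =>
    obtain ⟨x, rfl⟩ := Ideal.toCotangent_surjective _ m
    obtain ⟨x₁, hx₁⟩ := Ideal.toCotangent_surjective _ (sectionConormalEndo f e he heW v hv hev h hhv hW hh
      ((augIdeal _).toCotangent x))
    rw [LinearMap.baseChange_tmul, ← hx₁, cotangentFibreMap_tmul, cotangentFibreMap_tmul, map_smul,
      cotangentMap_cotangentChartEquiv A hU heU u hV heV hVU]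
    congr 1
    -- (K): `[res x₁] = [v^♯ x]` in `I_h/I_h²`
    have hK : (augIdeal (sectionAug f e he heW')).toCotangent
        ⟨algebraMap _ (ChartRing f (X.basicOpen (val h))) (x₁ : ChartRing f W),
          algebraMap_mem_augIdeal _ _ (sectionAug_algebraMap f e he heW h hh) x₁.2⟩ =
        (augIdeal (sectionAug f e he heW')).toCotangent ⟨restrictAlgHom f v hv h hhv (x : ChartRing f W),
          augIdeal_le_comap_restrictAlgHom f e he heW v hv hev h hhv hh x.2⟩ := by
      rw [← augCotangentLocalizationEquiv_toCotangent _ _ (sectionAug_algebraMap f e he heW h hh) h hh, hx₁,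
        augCotangentLocalizationEquiv_sectionConormalEndo, Ideal.mapCotangent_toCotangent]
    -- apply `conormalToChart` for the chart `W'` and the chart isomorphism for `V`
    have hK' := congrArg (fun w => cotangentChartEquiv A hV heV (conormalToChart f e he hW' heW' A p horig hV heV w)) hK
    simp only [conormalToChart_toCotangent] at hK'
    -- left-hand side: `u^♯ (p^♯ x) = p^♯_{W'} (v^♯ x)`
    have hL : (⟨(Hom.toSchemeHom u).appLE (p ⁻¹ᵁ W) (p ⁻¹ᵁ X.basicOpen (val h)) hVU (p.app W (val (x : ChartRing f W))),
        appLE_mem_chartIdeal A hU heU u hV heV hVU ⟨_, app_mem_chartIdeal f e he hW heW A p horig hU heU x x.2⟩⟩ :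
          chartIdeal A hV heV) =
        ⟨p.app (X.basicOpen (val h)) (val (restrictAlgHom f v hv h hhv (x : ChartRing f W))),
          app_mem_chartIdeal f e he hW' heW' A p horig hV heV _
            (augIdeal_le_comap_restrictAlgHom f e he heW v hv hev h hhv hh x.2)⟩ :=
      Subtype.ext (appLE_app_apply f A p v u hu h hhv hVU _)
    -- right-hand side: `p^♯_{W'} (res x₁) = res (p^♯ x₁) = (𝟙 A)^♯ (p^♯ x₁)`
    have hR : (⟨p.app (X.basicOpen (val h)) (val (algebraMap _ (ChartRing f (X.basicOpen (val h))) (x₁ : ChartRing f W))),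
        app_mem_chartIdeal f e he hW' heW' A p horig hV heV _
          (algebraMap_mem_augIdeal _ _ (sectionAug_algebraMap f e he heW h hh) x₁.2)⟩ : chartIdeal A hV heV) =
        ⟨(Hom.toSchemeHom (𝟙 A)).appLE (p ⁻¹ᵁ W) (p ⁻¹ᵁ X.basicOpen (val h)) hVU₁ (p.app W (val (x₁ : ChartRing f W))),
          appLE_mem_chartIdeal A hU heU (𝟙 A) hV heV hVU₁
            ⟨_, app_mem_chartIdeal f e he hW heW A p horig hU heU x₁ x₁.2⟩⟩ := by
      apply Subtype.ext
      change p.app (X.basicOpen (val h)) (X.presheaf.map (homOfLE (X.basicOpen_le (val h))).op (val (x₁ : ChartRing f W))) =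
        (Hom.toSchemeHom (𝟙 A)).appLE (p ⁻¹ᵁ W) (p ⁻¹ᵁ X.basicOpen (val h)) hVU₁ (p.app W (val (x₁ : ChartRing f W)))
      rw [id_appLE_apply, ← map_app_apply A p (X.basicOpen_le (val h))]
      exact congrArg (fun k => A.X.left.presheaf.map k (p.app W (val (x₁ : ChartRing f W))))
        (Quiver.Hom.unop_inj (Subsingleton.elim _ _))
    rw [hL, ← hK', hR, ← cotangentMap_cotangentChartEquiv A hU heU (𝟙 A) hV heV hVU₁
      ⟨p.app W (val (x₁ : ChartRing f W)), app_mem_chartIdeal f e he hW heW A p horig hU heU x₁ x₁.2⟩,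
      cotangentMap_id, LinearMap.id_apply]

include hW hP horig hev hu in
/-- The equivariance as an identity of `κ`-linear maps: `u^* ∘ Φ = Φ ∘ (κ ⊗ γ_v)` for the isomorphism
`Φ = cotangentFibreEquiv : κ ⊗_R I/I² ≃ T_e^*(A)`. [cite: GortzWedhorn2023, Remark 17.14] -/
theorem cotangentMap_comp_cotangentFibreEquiv :
    cotangentMap A u ∘ₗ (cotangentFibreEquiv f e he hW heW A p hP horig hU heU).toLinearMap =
      (cotangentFibreEquiv f e he hW heW A p hP horig hU heU).toLinearMap ∘ₗ
        (sectionConormalEndo f e he heW v hv hev h hhv hW hh).baseChange κ :=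
  LinearMap.ext fun z => cotangentMap_cotangentFibreMap f e he hW heW A p hP horig hU heU v hv hev u hu h hh hhv z

include hW hP horig hev hu in
/-- **`u^* = Φ ∘ (κ ⊗ γ_v) ∘ Φ⁻¹` on `T_e^*(A)`.** [cite: GortzWedhorn2023, Remark 17.14] -/
theorem cotangentMap_eq_conj :
    cotangentMap A u = (cotangentFibreEquiv f e he hW heW A p hP horig hU heU).conj
      ((sectionConormalEndo f e he heW v hv hev h hhv hW hh).baseChange κ) := by
  apply LinearMap.ext
  intro y
  obtain ⟨z, rfl⟩ := (cotangentFibreEquiv f e he hW heW A p hP horig hU heU).surjective y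
  rw [LinearEquiv.conj_apply, LinearMap.comp_apply, LinearMap.comp_apply, LinearEquiv.coe_coe, LinearEquiv.coe_coe,
    LinearEquiv.symm_apply_apply]
  exact cotangentMap_cotangentFibreMap f e he hW heW A p hP horig hU heU v hv hev u hu h hh hhv z

include hW hP horig hev hu hU heU in
/-- **The characteristic polynomial of `u^*` on the cotangent space of the fibre is the base change of the characteristic
polynomial of `γ_v` on the conormal module of the section**: if `I/I²` is free of finite rank over `R`, then
`char(u^* | T_e^*(A)) = char(γ_v | I/I²) ⊗_R κ` — the cotangent characteristic polynomial of an endomorphism of an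
`R`-model is ONE polynomial over `R`, read in every fibre (Shimura's specialisation argument for the type of a CM
structure, [Shimura1998] §12.4 Prop. 26, p. 109, in scheme language). [cite: GortzWedhorn2023, Remark 17.14 and Remark 17.15 (1)] [cite: GortzWedhorn2020, Remark 6.12 (2)–(3)] -/
theorem charpoly_cotangentMap_eq_map_charpoly [Module.Free R (augIdeal (sectionAug f e he heW)).Cotangent]
    [Module.Finite R (augIdeal (sectionAug f e he heW)).Cotangent] :
    (cotangentMap A u).charpoly =
      ((sectionConormalEndo f e he heW v hv hev h hhv hW hh).charpoly).map (algebraMap R κ) := by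
  rw [cotangentMap_eq_conj f e he hW heW A p hP horig hU heU v hv hev u hu h hh hhv, LinearEquiv.charpoly_conj,
    LinearMap.charpoly_baseChange]

end Endo

end AbelianVariety

end Literature.AlgebraicGeometry.Motives

end
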